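import Summits.Ventures.WeilGRH.KeyWindowDilation
import Summits.Ventures.WeilGRH.KeyParityTransfer
import HarnessLib

/-!
# GRH arm (rh-explicit, venture WeilGRH): the pseudo-key certificate AT ANY WINDOW, and the EVEN pseudo-key
  covers BOTH parities

Cell `rh-explicit`, WEIL TRACK (lit/typing seat weil-grh-5; corollaries joining `KeyWindowDilation.lean` (A36: one
certificate at the all-trivial key of parity `a` ⇒ every character of parity `a`, same window) with
`KeyParityTransfer.lean` (A22: the parity term is non-negative, `E_{0,L,v,N} ≤ E_{1,L,v,N}`).

`WeilPositivityOnKey a L v N` ties the window to `N` (`t_N = log(N+1)/2`); the pseudo-key certificates of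
weil-grh-2 gen5 live at arbitrary windows (`t = 1`, `4023/5000`, `log 2`), so the hypothesis is stated here at a
general window `t > 0`, in both the position form (`keyMarkovForm a L₀ 1 t g ≥ 0` for test `g` on `[-t, t]`) and
the spectral form (`E_{a,L₀,1,N}(g) ≥ 0` for test `g` on `[-t, t]`, any `N` with `e^{2t} ≤ N + 1`):
* ★★ `weilPositivityOnChar_of_allTrivial_test_nonneg` / `…_of_allTrivial_key_nonneg`: positivity of the all-trivial
  key of parity `a` and level `L₀` on TEST functions on `[-t, t]` ⇒ `WeilPositivityOnChar χ t` for every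
  `χ mod q ≠ 1` of parity `a` with `L₀ ≤ log q` — the same window `t` (minorant A35 + same-window transfer A36);
* ★★ `weilPositivityOnChar_of_allTrivial_even_key_nonneg`: the EVEN pseudo-key certificate (`a = 0`) gives EVERY
  character of either parity (weil-grh-2 MINORANT.md: «the even pseudo-key also minorises the odd characters»);
* the `t_N`-window forms: `weilPositivityOnChar_of_weilPositivityOnKey_allTrivial_any/_even/_even_self/_even_mod`.
With weil-grh-2 gen5's certificates (kit j181392: even pseudo-key `q₀ = 75`, odd `q₀ = 30`, `t = 1`) the
statement to instantiate is `weilPositivityOnChar_of_allTrivial_even_key_nonneg` with `t = 1`, `L₀ = log 75`,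
`N = 7` (every χ mod `q ≥ 75`) and `…_of_allTrivial_key_nonneg` with `a = 1`, `L₀ = log 30` (odd χ, `q ≥ 30`) — once
the certificates are typed as the displayed test-function positivity.
Everything is proved; no definitions; no named facts; RH/GRH-free. [folklore]
-/

set_option autoImplicit false

noncomputable section

open Set

namespace Summit.Ventures.WeilGRH

open Literature.NumberTheory.LFunctions
open Summit.RiemannHypothesis.RiemannHypothesis.Theorems.WeilFormatC

variable {q : ℕ}

/-! ## Any window: position form -/

/-- ★★ **Pseudo-key positivity on test functions ⇒ every character of that parity, SAME WINDOW.**  If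
`keyMarkovForm a L₀ 1 t g ≥ 0` for every Weil test function `g` supported in `[-t, t]` (`t > 0`), then
`WeilPositivityOnChar χ t` for every `χ mod q`, `q ≠ 1`, with `charParity χ = a` and `L₀ ≤ log q`.
(Minorant at `|g|`, a window function Lipschitz on `ℝ`; if its form were negative, the same-window transfer would
produce a test function with negative form.) (Statement: weil-grh-2 gen5, MINORANT.md.) [folklore] -/
theorem weilPositivityOnChar_of_allTrivial_test_nonneg {a : ℕ} {L₀ t : ℝ} (ht : 0 < t)
    (hpos : ∀ g : ℝ → ℂ, IsWeilTest g → tsupport g ⊆ Icc (-t) t → 0 ≤ keyMarkovForm a L₀ (fun _ ↦ 1) t g)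
    (hq : q ≠ 1) (χ : DirichletCharacter ℂ q) (hpar : charParity χ = a) (hL : L₀ ≤ Real.log q) :
    WeilPositivityOnChar χ t := by
  intro g hg hsupp
  have h := keyMarkovForm_allTrivial_le_re_weilQuadraticChar hq χ hg ht.le hsupp hL
  rw [hpar] at h
  refine le_trans ?_ h
  by_contra hneg
  obtain ⟨K, hK⟩ := exists_lipschitz_norm_of_isWeilTest hg
  have hlt : keyMarkovForm a L₀ (fun _ ↦ 1) t (fun x ↦ ((‖g x‖ : ℝ) : ℂ)) <
      0 * ∫ x, ‖(((‖g x‖ : ℝ) : ℂ))‖ ^ 2 := by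
    rw [zero_mul]
    exact not_le.1 hneg
  obtain ⟨h', hh', hsupp', hlt'⟩ := exists_isWeilTest_keyMarkovForm_lt_of_lipschitz ht
    (isWindowFunction_norm (isWindowFunction_of_isWeilTest hg hsupp)) hK a L₀ (fun _ ↦ 1) hlt
  rw [zero_mul] at hlt'
  exact absurd (hpos h' hh' hsupp') (not_le.2 hlt')

/-! ## Any window: spectral form -/

/-- ★★ **The same with the spectral hypothesis** `E_{a,L₀,1,N}(g) ≥ 0` for test `g` on `[-t, t]` (`a ≤ 1`,
`e^{2t} ≤ N + 1`, `t > 0`): every `χ mod q ≠ 1` of parity `a` with `L₀ ≤ log q` has `WeilPositivityOnChar χ t`.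
[folklore] -/
theorem weilPositivityOnChar_of_allTrivial_key_nonneg {a : ℕ} (ha : a ≤ 1) {L₀ t : ℝ} (ht : 0 < t) {N : ℕ}
    (hN : Real.exp (2 * t) ≤ (N : ℝ) + 1)
    (hpos : ∀ g : ℝ → ℂ, IsWeilTest g → tsupport g ⊆ Icc (-t) t →
      0 ≤ weilFinitePrimeQuadraticKey a L₀ (fun _ ↦ 1) N g)
    (hq : q ≠ 1) (χ : DirichletCharacter ℂ q) (hpar : charParity χ = a) (hL : L₀ ≤ Real.log q) :
    WeilPositivityOnChar χ t :=
  weilPositivityOnChar_of_allTrivial_test_nonneg ht (fun g hg hsupp ↦ by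
    rw [keyMarkovForm_eq_weilFinitePrimeQuadraticKey hg hsupp hN ha]
    exact hpos g hg hsupp) hq χ hpar hL

/-- ★★ **The EVEN pseudo-key certificate covers every character of either parity** (any window):
`E_{0,L₀,1,N}(g) ≥ 0` for test `g` on `[-t, t]` (`e^{2t} ≤ N + 1`, `t > 0`) ⇒ `WeilPositivityOnChar χ t` for every
`χ mod q ≠ 1` with `L₀ ≤ log q` (the parity term is non-negative: `E_{0,L,v,N} ≤ E_{1,L,v,N}`,
`weilFinitePrimeQuadraticKey_zero_le_one`). (Statement: weil-grh-2 gen5, MINORANT.md.) [folklore] -/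
theorem weilPositivityOnChar_of_allTrivial_even_key_nonneg {L₀ t : ℝ} (ht : 0 < t) {N : ℕ}
    (hN : Real.exp (2 * t) ≤ (N : ℝ) + 1)
    (hpos : ∀ g : ℝ → ℂ, IsWeilTest g → tsupport g ⊆ Icc (-t) t →
      0 ≤ weilFinitePrimeQuadraticKey 0 L₀ (fun _ ↦ 1) N g)
    (hq : q ≠ 1) (χ : DirichletCharacter ℂ q) (hL : L₀ ≤ Real.log q) : WeilPositivityOnChar χ t := by
  have ha := charParity_le_one χ
  refine weilPositivityOnChar_of_allTrivial_key_nonneg ha ht hN (fun g hg hsupp ↦ ?_) hq χ rfl hL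
  rcases Nat.le_one_iff_eq_zero_or_eq_one.1 ha with h0 | h1
  · rw [h0]
    exact hpos g hg hsupp
  · rw [h1]
    exact (hpos g hg hsupp).trans (weilFinitePrimeQuadraticKey_zero_le_one hg L₀ _ N)

/-- The even pseudo-key certificate with the level read off a modulus `q₀ ≥ 1`: every character mod `q ≥ q₀`,
`q ≠ 1`. [folklore] -/
theorem weilPositivityOnChar_of_allTrivial_even_key_nonneg_mod {q₀ : ℕ} {t : ℝ} (ht : 0 < t) {N : ℕ}
    (hN : Real.exp (2 * t) ≤ (N : ℝ) + 1)
    (hpos : ∀ g : ℝ → ℂ, IsWeilTest g → tsupport g ⊆ Icc (-t) t →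
      0 ≤ weilFinitePrimeQuadraticKey 0 (Real.log q₀) (fun _ ↦ 1) N g)
    (hq : q ≠ 1) (χ : DirichletCharacter ℂ q) (hqq : q₀ ≤ q) (hq₀ : q₀ ≠ 0) : WeilPositivityOnChar χ t :=
  weilPositivityOnChar_of_allTrivial_even_key_nonneg ht hN hpos hq χ
    (Real.log_le_log (by exact_mod_cast Nat.pos_of_ne_zero hq₀) (by exact_mod_cast hqq))

/-! ## The `t_N = log(N+1)/2` window: parity transfer of `WeilPositivityOnKey` -/

/-- ★ **A certificate of LOWER parity suffices**: `WeilPositivityOnKey a₀ L₀ 1 N` with `a₀ ≤ charParity χ` ⇒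
`WeilPositivityOnChar χ t` for `0 < t ≤ log(N+1)/2`, `q ≠ 1`, `L₀ ≤ log q` (`WeilPositivityOnKey.mono_parity` +
A36). [folklore] -/
theorem weilPositivityOnChar_of_weilPositivityOnKey_allTrivial_any {a₀ : ℕ} {L₀ : ℝ} {N : ℕ}
    (hpos : WeilPositivityOnKey a₀ L₀ (fun _ ↦ 1) N) {t : ℝ} (ht : 0 < t) (htN : t ≤ Real.log ((N : ℝ) + 1) / 2)
    (hq : q ≠ 1) (χ : DirichletCharacter ℂ q) (ha₀ : a₀ ≤ charParity χ) (hL : L₀ ≤ Real.log q) :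
    WeilPositivityOnChar χ t :=
  weilPositivityOnChar_of_weilPositivityOnKey_allTrivial_le (charParity_le_one χ)
    (hpos.mono_parity ha₀ (charParity_le_one χ)) ht htN hq χ rfl hL

/-- ★ **The EVEN pseudo-key certificate at `t_N` covers every character of either parity**:
`WeilPositivityOnKey 0 L₀ 1 N` ⇒ `WeilPositivityOnChar χ t` for every `χ mod q ≠ 1` with `L₀ ≤ log q`, every
`0 < t ≤ log(N+1)/2`. [folklore] -/
theorem weilPositivityOnChar_of_weilPositivityOnKey_allTrivial_even {L₀ : ℝ} {N : ℕ}
    (hpos : WeilPositivityOnKey 0 L₀ (fun _ ↦ 1) N) {t : ℝ} (ht : 0 < t) (htN : t ≤ Real.log ((N : ℝ) + 1) / 2)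
    (hq : q ≠ 1) (χ : DirichletCharacter ℂ q) (hL : L₀ ≤ Real.log q) : WeilPositivityOnChar χ t :=
  weilPositivityOnChar_of_weilPositivityOnKey_allTrivial_any hpos ht htN hq χ (Nat.zero_le _) hL

/-- The same AT the certificate's window `t = log(N+1)/2` (`N ≥ 1`). [folklore] -/
theorem weilPositivityOnChar_of_weilPositivityOnKey_allTrivial_even_self {L₀ : ℝ} {N : ℕ} (hN : 1 ≤ N)
    (hpos : WeilPositivityOnKey 0 L₀ (fun _ ↦ 1) N) (hq : q ≠ 1) (χ : DirichletCharacter ℂ q)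
    (hL : L₀ ≤ Real.log q) : WeilPositivityOnChar χ (Real.log ((N : ℝ) + 1) / 2) := by
  have hN' : (1 : ℝ) < (N : ℝ) + 1 := by
    have : (1 : ℝ) ≤ N := by exact_mod_cast hN
    linarith
  exact weilPositivityOnChar_of_weilPositivityOnKey_allTrivial_even hpos (div_pos (Real.log_pos hN') two_pos) le_rfl
    hq χ hL

/-- The same with the level read off a modulus: `WeilPositivityOnKey 0 (log q₀) 1 N`, `q ≥ q₀ ≥ 1` ⇒ every
character mod `q ≠ 1`, every `0 < t ≤ log(N+1)/2`. [folklore] -/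
theorem weilPositivityOnChar_of_weilPositivityOnKey_allTrivial_even_mod {q₀ : ℕ} {N : ℕ}
    (hpos : WeilPositivityOnKey 0 (Real.log q₀) (fun _ ↦ 1) N) {t : ℝ} (ht : 0 < t)
    (htN : t ≤ Real.log ((N : ℝ) + 1) / 2) (hq : q ≠ 1) (χ : DirichletCharacter ℂ q) (hqq : q₀ ≤ q)
    (hq₀ : q₀ ≠ 0) : WeilPositivityOnChar χ t :=
  weilPositivityOnChar_of_weilPositivityOnKey_allTrivial_even hpos ht htN hq χ
    (Real.log_le_log (by exact_mod_cast Nat.pos_of_ne_zero hq₀) (by exact_mod_cast hqq))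

end Summit.Ventures.WeilGRH

end
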